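import Summits.MatrixMultiplication.MatrixMultiplication.Theorems.EdgePencilExponent
import Literature.Computability.AlgebraicComplexity.RectangularExponentSymmetry
import HarnessLib

/-!
# The fat tetrahedron: grouping floor and the re-routing cover through a fat pendant

Support kernel for `stmt-MatrixMultiplication-26697` (`TetraExcessZero : ω(K₄) ≤ ω(2,1,2)`, the
attacked leaf of route `TetrahedronCarving`; lineage `decomp-mm-lens-6` «barrier-complement carving»,
generation 26, memo NODE-g26 §2 I-R3). No item is added or changed. Tensor layer; the exponent layer
(`ω_fat(k)`, the flat fat end of the extended sixth-edge ladder) is `EdgePencilFatEndExponent`.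

THE OBJECT. The sixth-edge ladder of the lineage (`EdgePencilSixthLadder`, format `sixTetra`) thins the
pendant edge `01` of `T(K₄)_n` to bond `n^δ ≤ n`. This module goes the other way: `fatTetra F B N` is
the tetrahedron tensor at level `B` with the five edges `02, 03, 12, 13, 23` thinned to bond `N ≤ B`, so
the pendant `01` keeps the FAT bond `B` (`fatTetra F N N = T(K₄)_N`, `fatTetra_self`).

THE RESULTS (every field).
* §2 GROUPING FLOOR `R(⟨B·N, N, N²⟩) ≤ R₄(fatTetra F B N)` (`1 ≤ N ≤ B`; group the vertices `{0,2}`),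
  hence the flattening floor `B·N³ ≤ R₄(fatTetra F B N)`.
* §3 THE RE-ROUTING COVER `R₄(fatTetra F (B₁B₂) N) ≤ R(⟨B₁,N,N⟩) · R(⟨B₂,N,N⟩) · N`: two rectangular
  triangles `012` (pendant share `B₁`) and `013` (share `B₂`) THROUGH the pendant, times the bare edge
  `23` — an explicit rank-one decomposition (`fatTetra_eq_sum_cover`).

References: Christandl–Vrana–Zuiddam, arXiv:1609.07476, Ex. 1.1.2, §1.1–§1.2 (graph tensors with
non-uniform bonds, covers, flattenings), Prop. 1.1.26 [ChristandlVranaZuiddam2016]; Bläser 2013,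
Lemma 7.1 (flattening of `⟨k,m,n⟩`) [Blaser2013]. No `sorry`, no new axiom, no instance, no notation.
-/

noncomputable section

set_option linter.dupNamespace false

open scoped BigOperators
open Filter Asymptotics Finset
open Literature.Computability.AlgebraicComplexity
open Summit.MatrixMultiplication.MatrixMultiplication.Theorems.TetrahedronTensor
open Summit.MatrixMultiplication.MatrixMultiplication.Theorems.TetraDiagonal

namespace Summit.MatrixMultiplication.MatrixMultiplication.Theorems.EdgePencil

/-! ## §1 The fat tetrahedron `fatTetra F B N` -/

section Defs

variable (F : Type*) [Field F]

/-- The thinning legs: vertex `0` tests its slots `1,2` (edges `02,03`), vertex `1` its slots `1,2`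
(edges `12,13`), vertex `2` its slot `2` (edge `23`) for labels `< N`. -/
def fatLegs (B N : ℕ) : Fin 4 → Fin (B ^ 3) → F :=
  ![fun x => thinInd F B N 1 x * thinInd F B N 2 x, fun x => thinInd F B N 1 x * thinInd F B N 2 x,
    fun x => thinInd F B N 2 x, fun _ => 1]

/-- **The fat tetrahedron** `fatTetra F B N`: the graph tensor of `K₄` with bond `B` on the edge `01` and
bond `N` on the other five edges, inside the format of `T(K₄)_B` (labels `≥ N` on the five thin edges
are killed). (CVZ19 Ex. 1.1.2, non-uniform bond dimensions). -/
def fatTetra (B N : ℕ) : (Fin 4 → Fin (B ^ 3)) → F :=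
  fun i => (∏ v, fatLegs F B N v (i v)) * tetra F B i

end Defs

section Basic

variable {F : Type*} [Field F]

/-- A thin indicator is the indicator of `lab x j < N`. -/
theorem thinInd_eq_ind {B N : ℕ} (j : Fin 3) (x : Fin (B ^ 3)) :
    thinInd F B N j x = ind ((lab x j : ℕ) < N) := rfl

/-- The leg product of `fatLegs`. -/
theorem prod_fatLegs {B N : ℕ} (i : Fin 4 → Fin (B ^ 3)) :
    ∏ v, fatLegs F B N v (i v) =
      ind ((lab (i 0) 1 : ℕ) < N) * ind ((lab (i 0) 2 : ℕ) < N) * ind ((lab (i 1) 1 : ℕ) < N) *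
        ind ((lab (i 1) 2 : ℕ) < N) * ind ((lab (i 2) 2 : ℕ) < N) := by
  rw [Fin.prod_univ_four]
  simp only [fatLegs, thinInd_eq_ind, Matrix.cons_val_zero, Matrix.cons_val_one, Matrix.cons_val_two,
    Matrix.cons_val_three, Matrix.head_cons, Matrix.tail_cons]
  ring

/-- Indicators of equivalent propositions agree. -/
theorem ind_congr {P Q : Prop} [Decidable P] [Decidable Q] (h : P ↔ Q) : (ind P : F) = ind Q :=
  if_congr h rfl rfl

/-- Pointwise value of `T(K₄)_B` as an indicator. -/
theorem tetra_eq_ind {B : ℕ} (i : Fin 4 → Fin (B ^ 3)) :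
    tetra F B i = ind (lab (i 0) 0 = lab (i 1) 0 ∧ lab (i 0) 1 = lab (i 2) 0 ∧
      lab (i 0) 2 = lab (i 3) 0 ∧ lab (i 1) 1 = lab (i 2) 1 ∧ lab (i 1) 2 = lab (i 3) 1 ∧
      lab (i 2) 2 = lab (i 3) 2) := by
  simp only [tetra, ind, lab]
  by_cases hc : consistent (fun v => (finFunctionFinEquiv.symm (i v) : Fin 3 → Fin B)) = true
  · rw [if_pos hc, if_pos ((consistent_iff _).1 hc)]
  · rw [if_neg hc, if_neg (fun h => hc ((consistent_iff _).2 h))]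

/-- **Pointwise value of the fat tetrahedron.** -/
theorem fatTetra_apply {B N : ℕ} (i : Fin 4 → Fin (B ^ 3)) :
    fatTetra F B N i = ind ((lab (i 0) 1 : ℕ) < N ∧ (lab (i 0) 2 : ℕ) < N ∧ (lab (i 1) 1 : ℕ) < N ∧
      (lab (i 1) 2 : ℕ) < N ∧ (lab (i 2) 2 : ℕ) < N ∧ (lab (i 0) 0 = lab (i 1) 0 ∧
        lab (i 0) 1 = lab (i 2) 0 ∧ lab (i 0) 2 = lab (i 3) 0 ∧ lab (i 1) 1 = lab (i 2) 1 ∧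
        lab (i 1) 2 = lab (i 3) 1 ∧ lab (i 2) 2 = lab (i 3) 2)) := by
  simp only [fatTetra, prod_fatLegs, tetra_eq_ind, ind_mul_ind, and_assoc]

/-- `fatTetra F B N` decomposes over rank-one tensors (leg-restriction of `T(K₄)_B`). -/
theorem fatTetra_decomposable (B N : ℕ) :
    ∃ s : ℕ, ∃ g : Fin s → ((Fin 4 → Fin (B ^ 3)) → F),
      (∀ k, g k ∈ rankOneTensors F (B ^ 3) 4) ∧ ∑ k, g k = fatTetra F B N :=
  legMul_decomposable (tetra F B) (fatLegs F B N) (tetra_decomposable B)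

/-- A rank-one decomposition of `fatTetra F B N` of length exactly its rank. [folklore] -/
theorem exists_rankOne_decomposition_fatTetra (B N : ℕ) :
    ∃ u : Fin (tensorRankD (fatTetra F B N)) → Fin 4 → Fin (B ^ 3) → F,
      ∑ k, rankOneTensor (u k) = fatTetra F B N := by
  classical
  obtain ⟨g, hg, hs⟩ := sComplexity_spec (fatTetra_decomposable (F := F) B N)
  simp only [rankOneTensors, Set.mem_range] at hg
  choose u hu using hg
  exact ⟨u, (Finset.sum_congr rfl fun k _ => hu k).trans hs⟩

/-- **Restriction** `R₄(fatTetra F B N) ≤ R₄(T(K₄)_B)`. [folklore] -/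
theorem tensorRankD_fatTetra_le_tetra (B N : ℕ) :
    tensorRankD (fatTetra F B N) ≤ tensorRankD (tetra F B) :=
  tensorRankD_legMul_le _ _ (tetra_decomposable B)

/-- **No thinning at `N = B`**: `fatTetra F N N = T(K₄)_N`. -/
theorem fatTetra_self (N : ℕ) : fatTetra F N N = tetra F N := by
  funext i
  have h : ∀ (j : Fin 3) (x : Fin (N ^ 3)), thinInd F N N j x = 1 := fun j x => by
    unfold thinInd; exact if_pos (Fin.is_lt _)
  simp only [fatTetra, Fin.prod_univ_four, fatLegs, Matrix.cons_val_zero, Matrix.cons_val_one,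
    Matrix.cons_val_two, Matrix.cons_val_three, Matrix.head_cons, Matrix.tail_cons, h]
  ring

end Basic

/-! ## §2 The grouping floor `R(⟨B·N, N, N²⟩) ≤ R₄(fatTetra F B N)` -/

section Grouping

variable {F : Type*} [Field F]

/-- The labels of an encoded vertex index. -/
@[simp] theorem lab_enc {n : ℕ} (x y z : Fin n) (j : Fin 3) : lab (enc x y z) j = ![x, y, z] j := by
  simp [lab, symm_enc]

/-- The grouped leg indices: vertices `{0,2}` ↦ the index `a = (⟨ℓ₀₁, ℓ₁₂⟩, ⟨ℓ₀₃, ℓ₂₃⟩)` of `⟨B·N, N, N²⟩`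
(the internal edge `02` frozen to the label `0`), vertex `1` ↦ `b = (⟨ℓ₀₁, ℓ₁₂⟩, ℓ₁₃)`, vertex `3` ↦
`c = (ℓ₁₃, ⟨ℓ₀₃, ℓ₂₃⟩)`; thin labels are cast into `Fin B`. -/
def groupLegs {B N : ℕ} [NeZero N] (hNB : N ≤ B) (a : Fin (B * N) × Fin (N * N))
    (b : Fin (B * N) × Fin N) (c : Fin N × Fin (N * N)) : Fin 4 → Fin (B ^ 3) :=
  ![enc (finProdFinEquiv.symm a.1).1 (Fin.castLE hNB 0) (Fin.castLE hNB (finProdFinEquiv.symm a.2).1),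
    enc (finProdFinEquiv.symm b.1).1 (Fin.castLE hNB (finProdFinEquiv.symm b.1).2) (Fin.castLE hNB b.2),
    enc (Fin.castLE hNB 0) (Fin.castLE hNB (finProdFinEquiv.symm a.1).2)
      (Fin.castLE hNB (finProdFinEquiv.symm a.2).2),
    enc (Fin.castLE hNB (finProdFinEquiv.symm c.2).1) (Fin.castLE hNB c.1)
      (Fin.castLE hNB (finProdFinEquiv.symm c.2).2)]

/-- **The grouped fat tetrahedron is `⟨B·N, N, N²⟩`**: at the grouped leg indices the fat tetrahedron
takes the value of the matrix multiplication tensor. [folklore] -/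
theorem fatTetra_groupLegs {B N : ℕ} [NeZero N] (hNB : N ≤ B) (a : Fin (B * N) × Fin (N * N))
    (b : Fin (B * N) × Fin N) (c : Fin N × Fin (N * N)) :
    fatTetra F B N (groupLegs hNB a b c) = matMulTensor F (B * N) N (N * N) a b c := by
  have e1 : a.1 = b.1 ↔ (finProdFinEquiv.symm a.1).1 = (finProdFinEquiv.symm b.1).1 ∧
      (finProdFinEquiv.symm a.1).2 = (finProdFinEquiv.symm b.1).2 := by
    rw [← Prod.ext_iff, Equiv.apply_eq_iff_eq]
  have e2 : a.2 = c.2 ↔ (finProdFinEquiv.symm a.2).1 = (finProdFinEquiv.symm c.2).1 ∧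
      (finProdFinEquiv.symm a.2).2 = (finProdFinEquiv.symm c.2).2 := by
    rw [← Prod.ext_iff, Equiv.apply_eq_iff_eq]
  rw [fatTetra_apply]
  simp only [groupLegs, Matrix.cons_val_zero, Matrix.cons_val_one, Matrix.cons_val_two,
    Matrix.cons_val_three, Matrix.head_cons, Matrix.tail_cons, lab_enc, Fin.val_castLE, Fin.is_lt, Fin.castLE_inj, true_and, matMulTensor, ind]
  refine if_congr ?_ rfl rfl
  constructor
  · rintro ⟨h01, h03, h12, h13, h23⟩
    exact ⟨e1.2 ⟨h01, h12.symm⟩, h13, e2.2 ⟨h03, h23⟩⟩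
  · rintro ⟨hab, hq, hac⟩
    exact ⟨(e1.1 hab).1, (e2.1 hac).1, (e1.1 hab).2.symm, hq, (e2.1 hac).2⟩

/-- **Grouping floor** `R(⟨B·N, N, N²⟩) ≤ R₄(fatTetra F B N)` (`1 ≤ N ≤ B`): group the endpoints of
the edge `02`. In exponents: `ω(k+1, 1, 2) ≤ ω_fat(k)`. [folklore] -/
theorem tensorRank_matMulTensor_le_tensorRankD_fatTetra {B N : ℕ} [NeZero N] (hNB : N ≤ B) :
    tensorRank (matMulTensor F (B * N) N (N * N)) ≤ tensorRankD (fatTetra F B N) := by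
  classical
  obtain ⟨u, hu⟩ := exists_rankOne_decomposition_fatTetra (F := F) B N
  refine tensorRank_le_of_eq_sum
    (fun k (a : Fin (B * N) × Fin (N * N)) =>
      u k 0 (enc (finProdFinEquiv.symm a.1).1 (Fin.castLE hNB 0)
          (Fin.castLE hNB (finProdFinEquiv.symm a.2).1)) *
        u k 2 (enc (Fin.castLE hNB 0) (Fin.castLE hNB (finProdFinEquiv.symm a.1).2)
          (Fin.castLE hNB (finProdFinEquiv.symm a.2).2)))
    (fun k (b : Fin (B * N) × Fin N) =>
      u k 1 (enc (finProdFinEquiv.symm b.1).1 (Fin.castLE hNB (finProdFinEquiv.symm b.1).2)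
        (Fin.castLE hNB b.2)))
    (fun k (c : Fin N × Fin (N * N)) =>
      u k 3 (enc (Fin.castLE hNB (finProdFinEquiv.symm c.2).1) (Fin.castLE hNB c.1)
        (Fin.castLE hNB (finProdFinEquiv.symm c.2).2))) ?_
  funext a b c
  have hpt := congrFun hu (groupLegs hNB a b c)
  rw [Finset.sum_apply, fatTetra_groupLegs hNB] at hpt
  rw [← hpt, Finset.sum_apply, Finset.sum_apply, Finset.sum_apply]
  refine Finset.sum_congr rfl fun k _ => ?_
  rw [rankOneTensor_apply, Fin.prod_univ_four, triad_apply]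
  simp only [groupLegs, Matrix.cons_val_zero, Matrix.cons_val_one, Matrix.cons_val_two,
    Matrix.cons_val_three, Matrix.head_cons, Matrix.tail_cons]
  ring

/-- **Flattening floor** `B·N³ ≤ R₄(fatTetra F B N)` (`1 ≤ N ≤ B`): the cut `{0,2} | {1,3}` crosses the
edges `01, 03, 12, 23`. [cite: ChristandlVranaZuiddam2016, §1.2 (flattening lower bound)] -/
theorem mul_pow_three_le_tensorRankD_fatTetra {B N : ℕ} [NeZero N] (hNB : N ≤ B) :
    B * N ^ 3 ≤ tensorRankD (fatTetra F B N) := by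
  have h := mul_le_tensorRank_matMulTensor F (B * N) N (N * N)
  have h' := tensorRank_matMulTensor_le_tensorRankD_fatTetra (F := F) hNB
  calc B * N ^ 3 = B * N * (N * N) := by ring
    _ ≤ _ := h.trans h'

end Grouping

/-! ## §3 The re-routing cover `R₄(fatTetra F (B₁B₂) N) ≤ R(⟨B₁,N,N⟩) · R(⟨B₂,N,N⟩) · N` -/

section Cover

variable {F : Type*} [Field F]

/-- Extension by zero of a function on `Fin N` to the labels `Fin L` (value `0` at labels `≥ N`). -/
def extN {L N : ℕ} (f : Fin N → F) (y : Fin L) : F :=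
  if h : (y : ℕ) < N then f ⟨y, h⟩ else 0

/-- Extension by zero of a function on `Fin N × Fin N` to pairs of labels in `Fin L`. -/
def extN₂ {L N : ℕ} (g : Fin N × Fin N → F) (y z : Fin L) : F :=
  if h : (y : ℕ) < N ∧ (z : ℕ) < N then g (⟨y, h.1⟩, ⟨z, h.2⟩) else 0

/-- Numeric orthogonality of indicators: `∑_{c < N} [a = c][b = c] = [a = b ∧ a < N]`. -/
theorem sum_ind_val_eq {N : ℕ} (a b : ℕ) :
    ∑ c : Fin N, (ind (a = (c : ℕ)) : F) * ind (b = (c : ℕ)) = ind (a = b ∧ a < N) := by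
  classical
  by_cases ha : a < N
  · rw [Finset.sum_eq_single_of_mem (⟨a, ha⟩ : Fin N) (Finset.mem_univ _)]
    · by_cases hb : b = a
      · subst hb; simp [ind, ha]
      · simp [ind, hb, Ne.symm hb, ha]
    · intro c _ hc
      have hac : a ≠ (c : ℕ) := fun h => hc (Fin.ext h.symm)
      simp [ind, hac]
  · have hz : ∀ c : Fin N, (ind (a = (c : ℕ)) : F) * ind (b = (c : ℕ)) = 0 := fun c => by
      have hac : a ≠ (c : ℕ) := fun h => ha (h ▸ c.is_lt)
      simp [ind, hac]
    rw [Finset.sum_congr rfl fun c _ => hz c, Finset.sum_const_zero, ind, if_neg (fun h => ha h.2)]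

/-- **One rectangular triangle of the cover, pointwise**: from `⟨B₀, N, N⟩ = ∑_k w_k ⊗ u_k ⊗ v_k`
(index `a = (α, t)` at vertex `0`, `b = (α', t')` at vertex `1`, `c` at the third vertex),
`∑_k w̃_k(α, y₁) · ũ_k(α', y₂) · ṽ_k(y₃, y₄) = [y₁,y₂,y₃,y₄ < N ∧ α = α' ∧ y₂ = y₃ ∧ y₁ = y₄]`
(`˜` = extension by zero in the thin labels). -/
theorem sum_triad_extN {B₀ N L r : ℕ} {w u : Fin r → Fin B₀ × Fin N → F}
    {v : Fin r → Fin N × Fin N → F} (hdec : matMulTensor F B₀ N N = ∑ j, triad (w j) (u j) (v j))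
    (α α' : Fin B₀) (y₁ y₂ y₃ y₄ : Fin L) :
    ∑ k, extN (fun t => w k (α, t)) y₁ * extN (fun t => u k (α', t)) y₂ * extN₂ (v k) y₃ y₄ =
      ind ((((y₁ : ℕ) < N ∧ (y₂ : ℕ) < N ∧ (y₃ : ℕ) < N ∧ (y₄ : ℕ) < N) ∧
        (α = α' ∧ (y₂ : ℕ) = y₃ ∧ (y₁ : ℕ) = y₄))) := by
  classical
  by_cases h₁ : (y₁ : ℕ) < N
  · by_cases h₂ : (y₂ : ℕ) < N
    · by_cases h₃ : (y₃ : ℕ) < N ∧ (y₄ : ℕ) < N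
      · have h := congrFun (congrFun (congrFun hdec (α, ⟨y₁, h₁⟩)) (α', ⟨y₂, h₂⟩))
          (⟨y₃, h₃.1⟩, ⟨y₄, h₃.2⟩)
        rw [Finset.sum_apply, Finset.sum_apply, Finset.sum_apply] at h
        simp only [triad_apply, matMulTensor] at h
        simp only [extN, extN₂, dif_pos h₁, dif_pos h₂, dif_pos h₃]
        rw [← h, ind]
        refine if_congr ?_ rfl rfl
        simp only [Fin.ext_iff]
        tauto
      · have hz : ∀ k, extN (fun t => w k (α, t)) y₁ * extN (fun t => u k (α', t)) y₂ *
            extN₂ (v k) y₃ y₄ = 0 := fun k => by simp [extN₂, dif_neg h₃]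
        rw [Finset.sum_congr rfl fun k _ => hz k, Finset.sum_const_zero, ind, if_neg]
        exact fun h => h₃ ⟨h.1.2.2.1, h.1.2.2.2⟩
    · have hz : ∀ k, extN (fun t => w k (α, t)) y₁ * extN (fun t => u k (α', t)) y₂ *
          extN₂ (v k) y₃ y₄ = 0 := fun k => by simp [extN, dif_neg h₂]
      rw [Finset.sum_congr rfl fun k _ => hz k, Finset.sum_const_zero, ind, if_neg]
      exact fun h => h₂ h.1.2.1
  · have hz : ∀ k, extN (fun t => w k (α, t)) y₁ * extN (fun t => u k (α', t)) y₂ *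
        extN₂ (v k) y₃ y₄ = 0 := fun k => by simp [extN, dif_neg h₁]
    rw [Finset.sum_congr rfl fun k _ => hz k, Finset.sum_const_zero, ind, if_neg]
    exact fun h => h₁ h.1.1

/-- The four legs of the cover summand indexed by `s = (k₁, k₂, c)`: `k₁` a triad index of
`⟨B₁, N, N⟩` (triangle `012`, pendant share `B₁`), `k₂` one of `⟨B₂, N, N⟩` (triangle `013`, share
`B₂`), `c` the label of the bare edge `23`; the pendant label `ℓ₀₁ ∈ Fin (B₁·B₂)` is split into its two
shares. (CVZ19 Prop. 1.1.26 (proof): covers multiply edge-wise). -/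
def fatCoverLeg {B₁ B₂ N r₁ r₂ : ℕ} (w₁ u₁ : Fin r₁ → Fin B₁ × Fin N → F)
    (v₁ : Fin r₁ → Fin N × Fin N → F) (w₂ u₂ : Fin r₂ → Fin B₂ × Fin N → F)
    (v₂ : Fin r₂ → Fin N × Fin N → F) (s : Fin r₁ × Fin r₂ × Fin N) :
    Fin 4 → Fin ((B₁ * B₂) ^ 3) → F :=
  ![fun x => extN (fun t => w₁ s.1 ((finProdFinEquiv.symm (lab x 0)).1, t)) (lab x 1) *
      extN (fun t => w₂ s.2.1 ((finProdFinEquiv.symm (lab x 0)).2, t)) (lab x 2),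
    fun x => extN (fun t => u₁ s.1 ((finProdFinEquiv.symm (lab x 0)).1, t)) (lab x 1) *
      extN (fun t => u₂ s.2.1 ((finProdFinEquiv.symm (lab x 0)).2, t)) (lab x 2),
    fun x => extN₂ (v₁ s.1) (lab x 1) (lab x 0) * ind ((lab x 2 : ℕ) = (s.2.2 : ℕ)),
    fun x => extN₂ (v₂ s.2.1) (lab x 1) (lab x 0) * ind ((lab x 2 : ℕ) = (s.2.2 : ℕ))]

/-- **The cover decomposition**: from triad decompositions of `⟨B₁, N, N⟩` and `⟨B₂, N, N⟩`,
`fatTetra F (B₁B₂) N = ∑_{(k₁,k₂,c)} ⊗_v fatCoverLeg_{(k₁,k₂,c)}(v)` (`r₁ · r₂ · N` rank-one terms).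
[cite: ChristandlVranaZuiddam2016, Prop. 1.1.26 (proof)] -/
theorem fatTetra_eq_sum_cover {B₁ B₂ N r₁ r₂ : ℕ} {w₁ u₁ : Fin r₁ → Fin B₁ × Fin N → F}
    {v₁ : Fin r₁ → Fin N × Fin N → F} {w₂ u₂ : Fin r₂ → Fin B₂ × Fin N → F}
    {v₂ : Fin r₂ → Fin N × Fin N → F}
    (h₁ : matMulTensor F B₁ N N = ∑ j, triad (w₁ j) (u₁ j) (v₁ j))
    (h₂ : matMulTensor F B₂ N N = ∑ j, triad (w₂ j) (u₂ j) (v₂ j)) :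
    ∑ s : Fin r₁ × Fin r₂ × Fin N, rankOneTensor (fatCoverLeg w₁ u₁ v₁ w₂ u₂ v₂ s) =
      fatTetra F (B₁ * B₂) N := by
  classical
  funext i
  -- the two shares of the pendant label at a vertex
  set π₁ : Fin ((B₁ * B₂) ^ 3) → Fin B₁ := fun x => (finProdFinEquiv.symm (lab x 0)).1 with hπ₁
  set π₂ : Fin ((B₁ * B₂) ^ 3) → Fin B₂ := fun x => (finProdFinEquiv.symm (lab x 0)).2 with hπ₂
  set X : Fin r₁ → F := fun k => extN (fun t => w₁ k (π₁ (i 0), t)) (lab (i 0) 1) *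
    extN (fun t => u₁ k (π₁ (i 1), t)) (lab (i 1) 1) * extN₂ (v₁ k) (lab (i 2) 1) (lab (i 2) 0)
    with hX
  set Y : Fin r₂ → F := fun k => extN (fun t => w₂ k (π₂ (i 0), t)) (lab (i 0) 2) *
    extN (fun t => u₂ k (π₂ (i 1), t)) (lab (i 1) 2) * extN₂ (v₂ k) (lab (i 3) 1) (lab (i 3) 0)
    with hY
  set Z : Fin N → F := fun c => ind ((lab (i 2) 2 : ℕ) = (c : ℕ)) * ind ((lab (i 3) 2 : ℕ) = (c : ℕ))
    with hZ
  have hterm : ∀ s : Fin r₁ × Fin r₂ × Fin N,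
      rankOneTensor (fatCoverLeg w₁ u₁ v₁ w₂ u₂ v₂ s) i = X s.1 * Y s.2.1 * Z s.2.2 := by
    rintro ⟨k₁, k₂, c⟩
    rw [rankOneTensor_apply, Fin.prod_univ_four]
    simp only [fatCoverLeg, Matrix.cons_val_zero, Matrix.cons_val_one, Matrix.cons_val_two,
      Matrix.cons_val_three, Matrix.head_cons, Matrix.tail_cons, hX, hY, hZ, hπ₁, hπ₂]
    ring
  have hsumX : ∑ k, X k = ind ((((lab (i 0) 1 : ℕ) < N ∧ (lab (i 1) 1 : ℕ) < N ∧
      (lab (i 2) 1 : ℕ) < N ∧ (lab (i 2) 0 : ℕ) < N) ∧ (π₁ (i 0) = π₁ (i 1) ∧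
        (lab (i 1) 1 : ℕ) = lab (i 2) 1 ∧ (lab (i 0) 1 : ℕ) = lab (i 2) 0))) :=
    sum_triad_extN h₁ _ _ _ _ _ _
  have hsumY : ∑ k, Y k = ind ((((lab (i 0) 2 : ℕ) < N ∧ (lab (i 1) 2 : ℕ) < N ∧
      (lab (i 3) 1 : ℕ) < N ∧ (lab (i 3) 0 : ℕ) < N) ∧ (π₂ (i 0) = π₂ (i 1) ∧
        (lab (i 1) 2 : ℕ) = lab (i 3) 1 ∧ (lab (i 0) 2 : ℕ) = lab (i 3) 0))) :=
    sum_triad_extN h₂ _ _ _ _ _ _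
  have hsumZ : ∑ c, Z c = ind ((lab (i 2) 2 : ℕ) = lab (i 3) 2 ∧ (lab (i 2) 2 : ℕ) < N) :=
    sum_ind_val_eq _ _
  have hπ : (π₁ (i 0) = π₁ (i 1) ∧ π₂ (i 0) = π₂ (i 1)) ↔ lab (i 0) 0 = lab (i 1) 0 := by
    rw [← Prod.ext_iff, Equiv.apply_eq_iff_eq]
  calc (∑ s : Fin r₁ × Fin r₂ × Fin N, rankOneTensor (fatCoverLeg w₁ u₁ v₁ w₂ u₂ v₂ s)) i
      = ∑ s : Fin r₁ × Fin r₂ × Fin N, X s.1 * Y s.2.1 * Z s.2.2 := by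
        rw [Finset.sum_apply]
        exact Finset.sum_congr rfl fun s _ => hterm s
    _ = ∑ k : Fin r₁, ∑ p : Fin r₂, ∑ q : Fin N, X k * Y p * Z q := by
        rw [Fintype.sum_prod_type]
        refine Finset.sum_congr rfl fun k _ => ?_
        rw [Fintype.sum_prod_type]
    _ = (∑ k, X k) * (∑ p, Y p) * (∑ q, Z q) := by
        rw [Finset.sum_mul_sum, Finset.sum_mul]
        refine Finset.sum_congr rfl fun k _ => ?_
        rw [Finset.sum_mul]
        refine Finset.sum_congr rfl fun p _ => ?_
        rw [Finset.mul_sum]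
    _ = fatTetra F (B₁ * B₂) N i := by
        rw [hsumX, hsumY, hsumZ, ind_mul_ind, ind_mul_ind, fatTetra_apply]
        refine ind_congr ?_
        rw [← hπ]
        constructor
        · rintro ⟨⟨⟨⟨t01, t11, -, -⟩, hp1, e12, e02⟩, ⟨t02, t12, -, -⟩, hp2, e13, e03⟩, e23, t22⟩
          exact ⟨t01, t02, t11, t12, t22, ⟨hp1, hp2⟩, Fin.ext e02, Fin.ext e03, Fin.ext e12,
            Fin.ext e13, Fin.ext e23⟩
        · rintro ⟨t01, t02, t11, t12, t22, ⟨hp1, hp2⟩, e02, e03, e12, e13, e23⟩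
          have v02 := Fin.ext_iff.1 e02
          have v03 := Fin.ext_iff.1 e03
          have v12 := Fin.ext_iff.1 e12
          have v13 := Fin.ext_iff.1 e13
          have v23 := Fin.ext_iff.1 e23
          exact ⟨⟨⟨⟨t01, t11, by omega, by omega⟩, hp1, v12, v02⟩, ⟨t02, t12, by omega, by omega⟩,
            hp2, v13, v03⟩, v23, t22⟩

/-- **The re-routing cover** `R₄(fatTetra F (B₁B₂) N) ≤ R(⟨B₁, N, N⟩) · R(⟨B₂, N, N⟩) · N`: two
rectangular triangles `012`, `013` through the pendant (shares `B₁`, `B₂` of its bond) and the bare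
edge `23`. [cite: ChristandlVranaZuiddam2016, Prop. 1.1.26] -/
theorem tensorRankD_fatTetra_le_cover (B₁ B₂ N : ℕ) :
    tensorRankD (fatTetra F (B₁ * B₂) N) ≤
      tensorRank (matMulTensor F B₁ N N) * tensorRank (matMulTensor F B₂ N N) * N := by
  classical
  obtain ⟨w₁, u₁, v₁, h₁⟩ := exists_triad_decomposition_tensorRank (matMulTensor F B₁ N N)
  obtain ⟨w₂, u₂, v₂, h₂⟩ := exists_triad_decomposition_tensorRank (matMulTensor F B₂ N N)
  have hsum := fatTetra_eq_sum_cover h₁ h₂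
  have hcard : Fintype.card (Fin (tensorRank (matMulTensor F B₁ N N)) ×
      Fin (tensorRank (matMulTensor F B₂ N N)) × Fin N) =
      tensorRank (matMulTensor F B₁ N N) * tensorRank (matMulTensor F B₂ N N) * N := by
    simp [mul_assoc]
  rw [← hcard]
  let e := Fintype.equivFin (Fin (tensorRank (matMulTensor F B₁ N N)) ×
    Fin (tensorRank (matMulTensor F B₂ N N)) × Fin N)
  refine tensorRankD_le_of_eq_sum (fun k => fatCoverLeg w₁ u₁ v₁ w₂ u₂ v₂ (e.symm k)) ?_
  rw [← hsum]
  exact Fintype.sum_equiv e.symm _ _ (fun _ => rfl)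

end Cover

end Summit.MatrixMultiplication.MatrixMultiplication.Theorems.EdgePencil

end
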